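import Literature.NumberTheory.Sieve.FGKMT2018MultidimensionalSieve
import Literature.NumberTheory.Sieve.SingularSeriesMultiplesMean
import HarnessLib

/-!
# Maynard's Proposition 9.4: the totient bookkeeping `(M/φ(M)) ∏_{p∣W, p∤Δ}(1 − 1/p) ≤ (B/φ(B)) (Δ/φ(Δ))`

Source: J. Maynard, *Dense clusters of primes in subsets*, Compositio Math. 152 (2016) =
arXiv:1405.2593 [Maynard2016DenseClusters], proof of Proposition 9.4 p. 26, final display (the factor
`Δ_L/φ(Δ_L)`); K. Ford, B. Green, S. Konyagin, J. Maynard, T. Tao, *Long gaps between primes*,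
JAMS 31 (2018), Thm 6 (iii) (7.14) p. 22.

In the assembly of Prop. 9.4 (P94-SPEC §1g) the one-dimensional sieve contributes `λ̃₁⁻¹ ≤ (M/φ(M))/log R₀`
with `M = W B Δ_L` (`log_le_mul_S0`), while the class count of the extended system gains
`φ_{ω⁺}(W) ≤ φ_ω(W) ∏_{p∣W, p∤Δ_L}(1 − 1/p)` (`phiOmega_cons_le_mul_prod`). This file records the elementary
combination (with `n/φ(n) = ∏_{p∣n} p/(p−1)`, `SingularSeriesMean.cast_div_totient`):
`(WBΔ/φ(WBΔ)) ∏_{p∣W, p∤Δ}(1 − 1/p) ≤ (B/φ(B)) (Δ/φ(Δ))` (`div_totient_mul_prod_le`): the primes of `W` not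
dividing `Δ` cancel exactly, and the remaining primes of `WBΔ` divide `B` or `Δ`.

## References
* J. Maynard, *Dense clusters of primes in subsets*, Compositio Math. 152 (2016), proof of Prop. 9.4
  p. 26 [Maynard2016DenseClusters].
* K. Ford, B. Green, S. Konyagin, J. Maynard, T. Tao, *Long gaps between primes*, JAMS 31 (2018),
  Thm 6 (iii) (7.14) p. 22 [FordGreenKonyaginMaynardTao2018].
-/

open Finset

namespace Literature.NumberTheory.Sieve.FGKMT2018

/-- Each factor `p/(p−1) ≥ 1`. [cite: FordGreenKonyaginMaynardTao2018, (7.14) p. 22] -/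
theorem one_le_div_sub_one {p : ℕ} (hp : p.Prime) : (1 : ℝ) ≤ (p : ℝ) / ((p : ℝ) - 1) := by
  have : (2 : ℝ) ≤ p := by exact_mod_cast hp.two_le
  rw [le_div_iff₀ (by linarith)]
  linarith

/-- `1 ≤ ∏_{p ∈ T} p/(p−1)` for a set of primes `T`. [cite: FordGreenKonyaginMaynardTao2018, (7.14) p. 22] -/
theorem one_le_prod_div_sub_one {T : Finset ℕ} (hT : ∀ p ∈ T, p.Prime) :
    (1 : ℝ) ≤ ∏ p ∈ T, ((p : ℝ) / ((p : ℝ) - 1)) :=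
  Finset.prod_induction _ (fun x : ℝ => 1 ≤ x) (fun _ _ ha hb => one_le_mul_of_one_le_of_one_le ha hb)
    le_rfl fun p hp => one_le_div_sub_one (hT p hp)

/-- Monotonicity in the index set: `S ⊆ T` (primes) gives `∏_S p/(p−1) ≤ ∏_T p/(p−1)`.
[cite: FordGreenKonyaginMaynardTao2018, (7.14) p. 22] -/
theorem prod_div_sub_one_mono {S T : Finset ℕ} (hST : S ⊆ T) (hT : ∀ p ∈ T, p.Prime) :
    ∏ p ∈ S, ((p : ℝ) / ((p : ℝ) - 1)) ≤ ∏ p ∈ T, ((p : ℝ) / ((p : ℝ) - 1)) := by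
  rw [← Finset.prod_sdiff hST]
  have h0 : 0 ≤ ∏ p ∈ S, ((p : ℝ) / ((p : ℝ) - 1)) :=
    Finset.prod_nonneg fun p hp => zero_le_one.trans (one_le_div_sub_one (hT p (hST hp)))
  have h1 : 1 ≤ ∏ p ∈ T \ S, ((p : ℝ) / ((p : ℝ) - 1)) :=
    one_le_prod_div_sub_one fun p hp => hT p (Finset.sdiff_subset hp)
  calc ∏ p ∈ S, ((p : ℝ) / ((p : ℝ) - 1)) = 1 * ∏ p ∈ S, ((p : ℝ) / ((p : ℝ) - 1)) := (one_mul _).symm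
    _ ≤ (∏ p ∈ T \ S, ((p : ℝ) / ((p : ℝ) - 1))) * ∏ p ∈ S, ((p : ℝ) / ((p : ℝ) - 1)) :=
        mul_le_mul_of_nonneg_right h1 h0

/-- Subadditivity over unions: `∏_{S ∪ T} p/(p−1) ≤ ∏_S p/(p−1) · ∏_T p/(p−1)` (primes).
[cite: FordGreenKonyaginMaynardTao2018, (7.14) p. 22] -/
theorem prod_div_sub_one_union_le {S T : Finset ℕ} (hS : ∀ p ∈ S, p.Prime) (hT : ∀ p ∈ T, p.Prime) :
    ∏ p ∈ S ∪ T, ((p : ℝ) / ((p : ℝ) - 1)) ≤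
      (∏ p ∈ S, ((p : ℝ) / ((p : ℝ) - 1))) * ∏ p ∈ T, ((p : ℝ) / ((p : ℝ) - 1)) := by
  classical
  rw [← Finset.prod_union_inter]
  have h0 : 0 ≤ ∏ p ∈ S ∪ T, ((p : ℝ) / ((p : ℝ) - 1)) :=
    Finset.prod_nonneg fun p hp => by
      rcases Finset.mem_union.1 hp with h | h
      · exact zero_le_one.trans (one_le_div_sub_one (hS p h))
      · exact zero_le_one.trans (one_le_div_sub_one (hT p h))
  have h1 : 1 ≤ ∏ p ∈ S ∩ T, ((p : ℝ) / ((p : ℝ) - 1)) :=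
    one_le_prod_div_sub_one fun p hp => hS p (Finset.mem_inter.1 hp).1
  exact le_mul_of_one_le_right h0 h1

/-- **The totient bookkeeping of Prop. 9.4**: for `W, B, D ≠ 0`,
`((WBD)/φ(WBD)) · ∏_{p ∣ W, p ∤ D}(1 − 1/p) ≤ (B/φ(B)) · (D/φ(D))`
(the primes of `W` not dividing `D` cancel; every other prime of `WBD` divides `B` or `D`).
[cite: Maynard2016DenseClusters, proof of Prop. 9.4 p. 26 (final display, Δ_L/φ(Δ_L)); FordGreenKonyaginMaynardTao2018, Thm 6 (iii) (7.14) p. 22] -/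
theorem div_totient_mul_prod_le {W B D : ℕ} (hW : W ≠ 0) (hB : B ≠ 0) (hD : D ≠ 0) :
    ((W * B * D : ℕ) : ℝ) / (Nat.totient (W * B * D) : ℝ) *
        ∏ p ∈ W.primeFactors.filter (fun p => ¬ p ∣ D), (1 - 1 / (p : ℝ)) ≤
      bOverPhi B * ((D : ℝ) / (Nat.totient D : ℝ)) := by
  classical
  have hM : W * B * D ≠ 0 := mul_ne_zero (mul_ne_zero hW hB) hD
  rw [SingularSeriesMean.cast_div_totient _ hM, bOverPhi, SingularSeriesMean.cast_div_totient _ hB,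
    SingularSeriesMean.cast_div_totient _ hD]
  set S₁ := W.primeFactors.filter (fun p => ¬ p ∣ D) with hS₁
  have hsub : S₁ ⊆ (W * B * D).primeFactors := by
    intro p hp
    have hpW := (Finset.mem_filter.1 hp).1
    exact Nat.mem_primeFactors.2 ⟨Nat.prime_of_mem_primeFactors hpW,
      (Nat.dvd_of_mem_primeFactors hpW).trans (Dvd.intro (B * D) (by ring)), hM⟩
  rw [← Finset.prod_sdiff hsub, mul_assoc, ← Finset.prod_mul_distrib]
  have hcancel : ∏ p ∈ S₁, ((p : ℝ) / ((p : ℝ) - 1) * (1 - 1 / (p : ℝ))) = 1 := by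
    refine Finset.prod_eq_one fun p hp => ?_
    have hpP := Nat.prime_of_mem_primeFactors (Finset.mem_filter.1 hp).1
    have h2 : (2 : ℝ) ≤ p := by exact_mod_cast hpP.two_le
    have h3 : (p : ℝ) - 1 ≠ 0 := (by linarith : (0 : ℝ) < (p : ℝ) - 1).ne'
    have h4 : (p : ℝ) ≠ 0 := (by linarith : (0 : ℝ) < (p : ℝ)).ne'
    rw [show (1 : ℝ) - 1 / (p : ℝ) = ((p : ℝ) - 1) / p by field_simp, div_mul_div_comm,
      mul_comm ((p : ℝ) - 1) (p : ℝ), div_self (mul_ne_zero h4 h3)]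
  rw [hcancel, mul_one]
  -- the remaining primes divide `B` or `D`
  have hrest : (W * B * D).primeFactors \ S₁ ⊆ B.primeFactors ∪ D.primeFactors := by
    intro p hp
    rw [Finset.mem_sdiff] at hp
    obtain ⟨hpM, hpS⟩ := hp
    have hpP := Nat.prime_of_mem_primeFactors hpM
    have hpd := Nat.dvd_of_mem_primeFactors hpM
    rw [Finset.mem_union, Nat.mem_primeFactors, Nat.mem_primeFactors]
    by_cases hpD : p ∣ D
    · exact Or.inr ⟨hpP, hpD, hD⟩
    · have hpW : ¬ p ∣ W := fun h => hpS (Finset.mem_filter.2 ⟨Nat.mem_primeFactors.2 ⟨hpP, h, hW⟩, hpD⟩)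
      rcases (Nat.Prime.dvd_mul hpP).1 hpd with h | h
      · rcases (Nat.Prime.dvd_mul hpP).1 h with h' | h'
        · exact absurd h' hpW
        · exact Or.inl ⟨hpP, h', hB⟩
      · exact absurd h hpD
  have hprimeU : ∀ p ∈ B.primeFactors ∪ D.primeFactors, p.Prime := fun p hp => by
    rcases Finset.mem_union.1 hp with h | h <;> exact Nat.prime_of_mem_primeFactors h
  exact (prod_div_sub_one_mono hrest hprimeU).trans
    (prod_div_sub_one_union_le (fun p hp => Nat.prime_of_mem_primeFactors hp)
      fun p hp => Nat.prime_of_mem_primeFactors hp)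

end Literature.NumberTheory.Sieve.FGKMT2018
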